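import Summits.CriticalPhenomena.PercolationContinuityZ3.Theorems.SahiBoxTP2BooleanSpins
import Summits.CriticalPhenomena.PercolationContinuityZ3.Theorems.SahiBoxTP2CellFKG

/-!
# Ordered spins embedded in `[0,1]` with both adjoints: finite-chain spins `{0, 1/m, …, 1}^ℕ`

Support file of the Sahi cell (`prim-sahi`, typer seat, generation 12; `--supports stmt-CriticalPhenomena-4575`).
Generalises `SahiBoxTP2BooleanSpins.lean` from `{0,1}` to an arbitrary countable spin lattice `Y` embedded in `[0,1]`
by a map `φ : Y → [0,1]` having a left adjoint `l` and a right adjoint `r` with `r ∘ φ = id` (then `r` is a monotone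
measurable left inverse, `measurable_of_galoisConnection_right`):

* `IsBoxTP2.map_embedSeq` — a box-TP₂ law on `Y^ℕ` embeds coordinatewise as a box-TP₂ law on the Hilbert cube;
  `msahiE_nonneg_of_isBoxTP2_embedded` (+ `_antitone`): **given `C_n`, every box-TP₂ probability measure on `Y^ℕ` is
  Sahi-positive of order `n`** for all measurable nonnegative monotone families; UNCONDITIONAL
  `integral_mul_integral_le_of_isBoxTP2_embedded` (FKG); `isBoxTP2_of_latticeCondition_marginals` (finite distributive
  `Y`: the FKG lattice condition on the cylinder probabilities of every initial segment suffices).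
* FINITE CHAINS `Y = Fin (m+1)`, `0 < m` (heights `k/m`): `chainPt`, `chainCeil ⊣ chainPt ⊣ chainFloor`
  (`galoisConnection_chainCeil/chainFloor`, `chainFloor_chainPt`); `msahiE_nonneg_of_latticeCondition_chainSpins`:
  **every probability measure on `{0,…,m}^ℕ` whose finite-dimensional cylinder probabilities satisfy the FKG lattice
  condition is Sahi-positive of order `n` given `C_n`, and positively associated unconditionally**
  (`integral_mul_integral_le_of_latticeCondition_chainSpins`).

No sorries, no new axioms.
-/

noncomputable section

namespace Summit.CriticalPhenomena.PercolationContinuityZ3.Theorems.SahiBoxTP2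

open MeasureTheory ProbabilityTheory Set Filter Topology Function Literature.Combinatorics.Sahi2008
open Literature.Combinatorics.Sahi2008.LebesgueSquare (gridPt)
open scoped ENNReal unitInterval

/-! ### Spin lattices embedded in `[0,1]` with both adjoints -/

section Generic

variable {Y : Type*} {φ : Y → I} {l r : I → Y}

/-- **A right adjoint into a countable poset is measurable**: `r⁻¹{y} = [φ y, 1] ∩ ⋂_{y' ≰ y} [φ y', 1]ᶜ`.
[folklore] -/
theorem measurable_of_galoisConnection_right [PartialOrder Y] [MeasurableSpace Y] [Countable Y]
    (hr : GaloisConnection φ r) : Measurable r := by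
  refine measurable_to_countable' fun y => ?_
  have hset : r ⁻¹' {y} = Ici (φ y) ∩ ⋂ (y' : Y) (_ : ¬ y' ≤ y), (Ici (φ y'))ᶜ := by
    ext t
    simp only [mem_preimage, mem_singleton_iff, mem_inter_iff, mem_Ici, mem_iInter, mem_compl_iff]
    constructor
    · rintro rfl
      exact ⟨hr.l_u_le t, fun y' hy' h => hy' ((hr y' t).1 h)⟩
    · rintro ⟨h1, h2⟩
      refine le_antisymm ?_ ((hr y t).1 h1)
      by_contra hne
      exact h2 (r t) hne (hr.l_u_le t)
  rw [hset]
  exact measurableSet_Ici.inter (MeasurableSet.iInter fun y' => MeasurableSet.iInter fun _ => measurableSet_Ici.compl)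

variable (φ r)

/-- The coordinatewise embedding `Y^ℕ → [0,1]^ℕ`. -/
def embedSeq (u : ℕ → Y) : ℕ → I := fun k => φ (u k)

/-- The coordinatewise rounding `[0,1]^ℕ → Y^ℕ` by the right adjoint. -/
def roundSeq (v : ℕ → I) : ℕ → Y := fun k => r (v k)

variable {φ r}

/-- The embedding is measurable. [folklore] -/
theorem measurable_embedSeq [MeasurableSpace Y] [MeasurableSingletonClass Y] [Countable Y] :
    Measurable (embedSeq φ) :=
  measurable_pi_lambda _ fun k => (measurable_of_countable φ).comp (measurable_pi_apply k)

/-- The rounding is measurable. [folklore] -/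
theorem measurable_roundSeq [PartialOrder Y] [MeasurableSpace Y] [Countable Y] (hr : GaloisConnection φ r) :
    Measurable (roundSeq r) :=
  measurable_pi_lambda _ fun k => (measurable_of_galoisConnection_right hr).comp (measurable_pi_apply k)

/-- The rounding is monotone. [folklore] -/
theorem roundSeq_mono [Preorder Y] (hr : GaloisConnection φ r) : Monotone (roundSeq r) :=
  fun _ _ h k => hr.monotone_u (h k)

/-- The embedding is monotone. [folklore] -/
theorem embedSeq_mono [Preorder Y] (hr : GaloisConnection φ r) : Monotone (embedSeq φ) :=
  fun _ _ h k => hr.monotone_l (h k)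

/-- Rounding after embedding is the identity (when `r ∘ φ = id`). [folklore] -/
theorem roundSeq_embedSeq (hleft : ∀ y, r (φ y) = y) (u : ℕ → Y) : roundSeq r (embedSeq φ u) = u :=
  funext fun k => hleft (u k)

section Lattice

variable [Lattice Y] [MeasurableSpace Y] [MeasurableSingletonClass Y] [Countable Y]

/-- **A box-TP₂ law on `Y^ℕ` embeds as a box-TP₂ law on the Hilbert cube.** [this work] -/
theorem IsBoxTP2.map_embedSeq {μ : Measure (ℕ → Y)} (hμ : IsBoxTP2 μ) (hl : GaloisConnection l φ)
    (hr : GaloisConnection φ r) : IsBoxTP2 (μ.map (embedSeq φ)) :=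
  hμ.map_of_galoisConnection measurable_embedSeq (galoisConnection_piMap hl) (galoisConnection_piMap hr)
    fun _ _ => measurableSet_Icc

variable {n : ℕ}

/-- **`(∀ d, LiebSahiContinuum d n)` ⟹ every box-TP₂ probability measure on `Y^ℕ` is Sahi-positive of order `n`**, for a
spin lattice `Y` embedded in `[0,1]` with both adjoints (`r ∘ φ = id`). [this work] -/
theorem msahiE_nonneg_of_isBoxTP2_embedded (hl : GaloisConnection l φ) (hr : GaloisConnection φ r)
    (hleft : ∀ y, r (φ y) = y) (hL : ∀ d, LiebSahiContinuum d n) (μ : Measure (ℕ → Y)) [IsProbabilityMeasure μ]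
    (hμ : IsBoxTP2 μ) (f : Fin n → (ℕ → Y) → ℝ) (hfm : ∀ i, Measurable (f i)) (hf0 : ∀ i u, 0 ≤ f i u)
    (hmono : ∀ i, Monotone (f i)) : 0 ≤ msahiE μ n f := by
  haveI : IsProbabilityMeasure (μ.map (embedSeq φ)) :=
    Measure.isProbabilityMeasure_map measurable_embedSeq.aemeasurable
  have hmp : MeasurePreserving (embedSeq φ) μ (μ.map (embedSeq φ)) := ⟨measurable_embedSeq, rfl⟩
  have key := msahiE_nonneg_of_isBoxTP2_hilbert hL (μ.map (embedSeq φ)) (hμ.map_embedSeq hl hr)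
    (fun i => f i ∘ roundSeq r) (fun i => (hfm i).comp (measurable_roundSeq hr)) (fun i v => hf0 i _)
    fun i v w hvw => hmono i (roundSeq_mono hr hvw)
  rw [← msahiE_comp_measurePreserving_of_measurable hmp n _ fun i => (hfm i).comp (measurable_roundSeq hr)] at key
  have e : (fun i => (f i ∘ roundSeq r) ∘ embedSeq φ) = f := by
    funext i u
    simp only [Function.comp_apply, roundSeq_embedSeq hleft]
  rwa [e] at key

/-- Decreasing families. [this work] -/
theorem msahiE_nonneg_of_isBoxTP2_embedded_antitone (hl : GaloisConnection l φ) (hr : GaloisConnection φ r)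
    (hleft : ∀ y, r (φ y) = y) (hL : ∀ d, LiebSahiContinuum d n) (μ : Measure (ℕ → Y)) [IsProbabilityMeasure μ]
    (hμ : IsBoxTP2 μ) (f : Fin n → (ℕ → Y) → ℝ) (hfm : ∀ i, Measurable (f i)) (hf0 : ∀ i u, 0 ≤ f i u)
    (hanti : ∀ i, Antitone (f i)) : 0 ≤ msahiE μ n f := by
  haveI : IsProbabilityMeasure (μ.map (embedSeq φ)) :=
    Measure.isProbabilityMeasure_map measurable_embedSeq.aemeasurable
  have hmp : MeasurePreserving (embedSeq φ) μ (μ.map (embedSeq φ)) := ⟨measurable_embedSeq, rfl⟩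
  have key := msahiE_nonneg_of_isBoxTP2_hilbert_antitone hL (μ.map (embedSeq φ)) (hμ.map_embedSeq hl hr)
    (fun i => f i ∘ roundSeq r) (fun i => (hfm i).comp (measurable_roundSeq hr)) (fun i v => hf0 i _)
    fun i v w hvw => hanti i (roundSeq_mono hr hvw)
  rw [← msahiE_comp_measurePreserving_of_measurable hmp n _ fun i => (hfm i).comp (measurable_roundSeq hr)] at key
  have e : (fun i => (f i ∘ roundSeq r) ∘ embedSeq φ) = f := by
    funext i u
    simp only [Function.comp_apply, roundSeq_embedSeq hleft]
  rwa [e] at key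

/-- **Unconditionally: the FKG inequality** for box-TP₂ laws on `Y^ℕ`. [this work] -/
theorem integral_mul_integral_le_of_isBoxTP2_embedded (hl : GaloisConnection l φ) (hr : GaloisConnection φ r)
    (hleft : ∀ y, r (φ y) = y) (μ : Measure (ℕ → Y)) [IsProbabilityMeasure μ] (hμ : IsBoxTP2 μ)
    {f g : (ℕ → Y) → ℝ} (hfm : Measurable f) (hgm : Measurable g) (hf0 : ∀ u, 0 ≤ f u) (hg0 : ∀ u, 0 ≤ g u)
    (hf : Monotone f) (hg : Monotone g) : (∫ u, f u ∂μ) * (∫ u, g u ∂μ) ≤ ∫ u, f u * g u ∂μ := by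
  have h := msahiE_nonneg_of_isBoxTP2_embedded hl hr hleft (fun d => liebSahiContinuum_of_order_le_two d le_rfl) μ hμ
    ![f, g] (fun i => by fin_cases i <;> assumption) (fun i => by fin_cases i <;> assumption)
    (fun i => by fin_cases i <;> assumption)
  rw [msahiE_two] at h
  linarith

end Lattice

/-- **Finite distributive spin lattices: the FKG lattice condition on the cylinder probabilities of every initial
segment gives box-TP₂** (four functions on boxes, marginal by marginal). [this work] -/
theorem isBoxTP2_of_latticeCondition_marginals {Y : Type*} [DistribLattice Y] [BoundedOrder Y] [Fintype Y]
    [MeasurableSpace Y] [MeasurableSingletonClass Y] (μ : Measure (ℕ → Y)) [IsFiniteMeasure μ]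
    (hfkg : ∀ (d : ℕ) (x y : Fin d → Y),
      μ.real {u | finRestrict d u = x} * μ.real {u | finRestrict d u = y} ≤
        μ.real {u | finRestrict d u = x ⊓ y} * μ.real {u | finRestrict d u = x ⊔ y}) : IsBoxTP2 μ := by
  have hIcc : ∀ (d : ℕ) (a b : Fin d → Y), MeasurableSet (Icc a b) := fun d a b => (Set.toFinite _).measurableSet
  refine (isBoxTP2_iff_forall_map_finRestrict hIcc).2 fun d => ?_
  haveI : IsFiniteMeasure (μ.map (finRestrict d)) := Measure.isFiniteMeasure_map μ _
  refine isBoxTP2_of_latticeCondition_singleton _ fun a b => ?_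
  have e : ∀ x : Fin d → Y, (μ.map (finRestrict d)).real {x} = μ.real {u | finRestrict d u = x} := fun x => by
    rw [measureReal_def, Measure.map_apply (measurable_finRestrict d) (measurableSet_singleton x), ← measureReal_def]
    rfl
  simp only [e]
  exact hfkg d a b

end Generic

/-! ### Finite chains `{0, 1/m, …, 1}` -/

section Chain

variable {m : ℕ}

/-- The height `k/m ∈ [0,1]` of the spin `k ∈ {0,…,m}`. -/
def chainPt (m : ℕ) (k : Fin (m + 1)) : I := gridPt m k

/-- Right adjoint (rounding down): `t ↦ min(⌊t·m⌋, m)`. -/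
def chainFloor (m : ℕ) (t : I) : Fin (m + 1) := ⟨min ⌊(t : ℝ) * m⌋₊ m, Nat.lt_succ_of_le (min_le_right _ _)⟩

/-- Left adjoint (rounding up): `a ↦ min(⌈a·m⌉, m)`. -/
def chainCeil (m : ℕ) (a : I) : Fin (m + 1) := ⟨min ⌈(a : ℝ) * m⌉₊ m, Nat.lt_succ_of_le (min_le_right _ _)⟩

/-- The height of spin `k` is `k/m` (`0 < m`). [folklore] -/
theorem coe_chainPt (hm : 0 < m) (k : Fin (m + 1)) : ((chainPt m k : I) : ℝ) = (k : ℝ) / m :=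
  coe_gridPt_eq_div hm (Nat.le_of_lt_succ k.2)

/-- `ι(k) ≤ t ↔ k ≤ ⌊t⌋` (`0 < m`). [folklore] -/
theorem galoisConnection_chainFloor (hm : 0 < m) : GaloisConnection (chainPt m) (chainFloor m) := by
  intro k t
  have hm' : (0 : ℝ) < m := by exact_mod_cast hm
  rw [Fin.le_def]
  change ((chainPt m k : I) : ℝ) ≤ (t : ℝ) ↔ (k : ℕ) ≤ min ⌊(t : ℝ) * m⌋₊ m
  rw [coe_chainPt hm, le_min_iff, Nat.le_floor_iff (mul_nonneg t.2.1 hm'.le), div_le_iff₀ hm']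
  exact ⟨fun h => ⟨h, Nat.le_of_lt_succ k.2⟩, fun h => h.1⟩

/-- `⌈a⌉ ≤ k ↔ a ≤ ι(k)` (`0 < m`). [folklore] -/
theorem galoisConnection_chainCeil (hm : 0 < m) : GaloisConnection (chainCeil m) (chainPt m) := by
  intro a k
  have hm' : (0 : ℝ) < m := by exact_mod_cast hm
  have hceil : ⌈(a : ℝ) * m⌉₊ ≤ m := Nat.ceil_le.2 (by
    have := a.2.2
    calc (a : ℝ) * m ≤ 1 * m := mul_le_mul_of_nonneg_right this hm'.le
      _ = (m : ℕ) := by rw [one_mul])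
  rw [Fin.le_def]
  change min ⌈(a : ℝ) * m⌉₊ m ≤ (k : ℕ) ↔ (a : ℝ) ≤ ((chainPt m k : I) : ℝ)
  rw [min_eq_left hceil, coe_chainPt hm, Nat.ceil_le, le_div_iff₀ hm']

/-- `⌊ι(k)⌋ = k` (`0 < m`). [folklore] -/
theorem chainFloor_chainPt (hm : 0 < m) (k : Fin (m + 1)) : chainFloor m (chainPt m k) = k := by
  have hm' : (0 : ℝ) < m := by exact_mod_cast hm
  refine Fin.ext ?_
  change min ⌊((chainPt m k : I) : ℝ) * m⌋₊ m = (k : ℕ)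
  rw [coe_chainPt hm, div_mul_cancel₀ _ hm'.ne', Nat.floor_natCast, min_eq_left (Nat.le_of_lt_succ k.2)]

variable {n : ℕ}

/-- **Finite-chain spins: `(∀ d, LiebSahiContinuum d n)` ⟹ every box-TP₂ probability measure on `{0,…,m}^ℕ` is
Sahi-positive of order `n`** for all measurable nonnegative monotone families. [this work] -/
theorem msahiE_nonneg_of_isBoxTP2_chainSpins (hm : 0 < m) (hL : ∀ d, LiebSahiContinuum d n)
    (μ : Measure (ℕ → Fin (m + 1))) [IsProbabilityMeasure μ] (hμ : IsBoxTP2 μ) (f : Fin n → (ℕ → Fin (m + 1)) → ℝ)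
    (hfm : ∀ i, Measurable (f i)) (hf0 : ∀ i u, 0 ≤ f i u) (hmono : ∀ i, Monotone (f i)) : 0 ≤ msahiE μ n f :=
  msahiE_nonneg_of_isBoxTP2_embedded (galoisConnection_chainCeil hm) (galoisConnection_chainFloor hm)
    (chainFloor_chainPt hm) hL μ hμ f hfm hf0 hmono

/-- **Finite-chain spins with FKG-lattice cylinder probabilities: `C_n` ⟹ Sahi positivity of order `n`.** [this work] -/
theorem msahiE_nonneg_of_latticeCondition_chainSpins (hm : 0 < m) (hL : ∀ d, LiebSahiContinuum d n)
    (μ : Measure (ℕ → Fin (m + 1))) [IsProbabilityMeasure μ]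
    (hfkg : ∀ (d : ℕ) (x y : Fin d → Fin (m + 1)),
      μ.real {u | finRestrict d u = x} * μ.real {u | finRestrict d u = y} ≤
        μ.real {u | finRestrict d u = x ⊓ y} * μ.real {u | finRestrict d u = x ⊔ y})
    (f : Fin n → (ℕ → Fin (m + 1)) → ℝ) (hfm : ∀ i, Measurable (f i)) (hf0 : ∀ i u, 0 ≤ f i u)
    (hmono : ∀ i, Monotone (f i)) : 0 ≤ msahiE μ n f :=
  msahiE_nonneg_of_isBoxTP2_chainSpins hm hL μ (isBoxTP2_of_latticeCondition_marginals μ hfkg) f hfm hf0 hmono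

/-- Decreasing families on `{0,…,m}^ℕ`. [this work] -/
theorem msahiE_nonneg_of_isBoxTP2_chainSpins_antitone (hm : 0 < m) (hL : ∀ d, LiebSahiContinuum d n)
    (μ : Measure (ℕ → Fin (m + 1))) [IsProbabilityMeasure μ] (hμ : IsBoxTP2 μ) (f : Fin n → (ℕ → Fin (m + 1)) → ℝ)
    (hfm : ∀ i, Measurable (f i)) (hf0 : ∀ i u, 0 ≤ f i u) (hanti : ∀ i, Antitone (f i)) : 0 ≤ msahiE μ n f :=
  msahiE_nonneg_of_isBoxTP2_embedded_antitone (galoisConnection_chainCeil hm) (galoisConnection_chainFloor hm)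
    (chainFloor_chainPt hm) hL μ hμ f hfm hf0 hanti

/-- **Unconditionally: finite-chain spin systems with FKG-lattice cylinder probabilities are positively associated**
for all measurable nonnegative monotone functionals of the whole configuration. [this work] -/
theorem integral_mul_integral_le_of_latticeCondition_chainSpins (hm : 0 < m) (μ : Measure (ℕ → Fin (m + 1)))
    [IsProbabilityMeasure μ]
    (hfkg : ∀ (d : ℕ) (x y : Fin d → Fin (m + 1)),
      μ.real {u | finRestrict d u = x} * μ.real {u | finRestrict d u = y} ≤
        μ.real {u | finRestrict d u = x ⊓ y} * μ.real {u | finRestrict d u = x ⊔ y})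
    {f g : (ℕ → Fin (m + 1)) → ℝ} (hfm : Measurable f) (hgm : Measurable g) (hf0 : ∀ u, 0 ≤ f u) (hg0 : ∀ u, 0 ≤ g u)
    (hf : Monotone f) (hg : Monotone g) : (∫ u, f u ∂μ) * (∫ u, g u ∂μ) ≤ ∫ u, f u * g u ∂μ :=
  integral_mul_integral_le_of_isBoxTP2_embedded (galoisConnection_chainCeil hm) (galoisConnection_chainFloor hm)
    (chainFloor_chainPt hm) μ (isBoxTP2_of_latticeCondition_marginals μ hfkg) hfm hgm hf0 hg0 hf hg

end Chain

end Summit.CriticalPhenomena.PercolationContinuityZ3.Theorems.SahiBoxTP2
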